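import Summits.HubbardSuperconductivity.HubbardSuperconductivity.Theses.WidthHaldane

/-! glue-summed.lean — the deciding theorem of route WidthHaldane RE-GLUED on `SummedDiagonalBridge`
(strategist r1 certificate for the tenure planner's `ledger route edit <route> --closes-file glue-summed.lean`,
to be used AFTER `workitem add … --name SummedDiagonalBridge --signature "$(cat SummedDiagonalBridgeRaw.sig)"`).
In the route file the hypothesis `h1` is the item decl `SummedDiagonalBridge`; in THIS self-contained test copy it is
spelled out as the raw signature (character-identical), so that `lean check` certifies the proof text today. -/

namespace Summit.HubbardSuperconductivity.HubbardSuperconductivity.Theses.WidthHaldane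

open scoped BigOperators Topology Manifold Classical MeasureTheory ProbabilityTheory Matrix InnerProductSpace ComplexConjugate ContinuousMap
open Filter Set Function TopologicalSpace MeasureTheory
open Literature.Hubbard

/-- Test copy of the item (raw signature, = `StrategistR1.SummedDiagonalBridgeRaw`). -/
def SummedDiagonalBridgeRawTest : Prop :=
  open Matrix Literature.MathematicalPhysics.QuantumLattice in let H0 : ∀ (L M : ℕ) (Λ : Type) [LinearOrder Λ] [Fintype Λ], (Λ ≃ ZMod L × ZMod M) → ℝ → Matrix (Finset (Orb Λ)) (Finset (Orb Λ)) ℂ := fun _ _ Λ _ _ e U => hamiltonian (SimpleGraph.fromRel fun x y : Λ => y = e.symm ((e x).1 + 1, (e x).2) ∨ y = e.symm ((e x).1, (e x).2 + 1)) 1 U; let Tw : ∀ (L M : ℕ) [NeZero L] [NeZero M] (Λ : Type) [LinearOrder Λ] [Fintype Λ], (Λ ≃ ZMod L × ZMod M) → ℝ → Matrix (Finset (Orb Λ)) (Finset (Orb Λ)) ℂ := fun _ M _ _ _ _ _ e θ => ∑ b : ZMod M, ∑ σ : Fin 2, ((1 - Complex.exp (Complex.I * θ)) • (creation (orb (e.symm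 (0, b)) σ) * annihilation (orb (e.symm (-1, b)) σ)) + (1 - Complex.exp (-(Complex.I * θ))) • (creation (orb (e.symm (-1, b)) σ) * annihilation (orb (e.symm (0, b)) σ))); let E : ∀ (L M : ℕ) [NeZero L] [NeZero M] (Λ : Type) [LinearOrder Λ] [Fintype Λ], (Λ ≃ ZMod L × ZMod M) → ℝ → ℝ → ℕ → ℝ := fun L M _ _ Λ _ _ e U θ N => (H0 L M Λ e U + Tw L M Λ e θ).minEnergyOn (szSector N 0); let Np : ℕ → ℕ → ℝ → ℕ := fun L M δ => 2 * ⌊(1 - δ) * ((L : ℝ) * (M : ℝ)) / 2⌋₊; let stiff : ∀ (L M : ℕ) [NeZero L] [NeZero M] (Λ : Type) [LinearOrder Λ] [Fintype Λ], (Λ ≃ ZMod L × ZMod M) → ℝ → ℝ → ℝ := fun L M _ _ Λ _ _ e U δ => 2 * (L : ℝ) * (E L M Λ e U (Real.pi / 3) (Np L M δ) - E L M Λ e U 0 (Np L M δ)) / ((Real.pi / 3) ^ 2 * (M : ℝ)); let icomp : ∀ (L M : ℕ) [NeZero L] [NeZero M] (Λ : Type) [LinearOrder Λ] [Fintype Λ],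 (Λ ≃ ZMod L × ZMod M) → ℝ → ℝ → ℝ := fun L M _ _ Λ _ _ e U δ => (L : ℝ) * (M : ℝ) * (E L M Λ e U 0 (Np L M δ + 2) + E L M Λ e U 0 (Np L M δ - 2) - 2 * E L M Λ e U 0 (Np L M δ)) / 4; let P : ∀ (L M : ℕ) (Λ : Type) [LinearOrder Λ] [Fintype Λ], (Λ ≃ ZMod L × ZMod M) → Λ → Matrix (Finset (Orb Λ)) (Finset (Orb Λ)) ℂ := fun _ _ Λ _ _ e x => ∑ j : Fin 4, (((![1, 1, -1, -1] : Fin 4 → ℝ) j / Real.sqrt 2 : ℝ) : ℂ) • (annihilation (orb x 0) * annihilation (orb ((![e.symm ((e x).1 + 1, (e x).2), e.symm ((e x).1 - 1, (e x).2), e.symm ((e x).1, (e x).2 + 1), e.symm ((e x).1, (e x).2 - 1)] : Fin 4 → Λ) j) 1) - annihilation (orb x 1) * annihilation (orb ((![e.symm ((e x).1 + 1, (e x).2), e.symm ((e x).1 - 1, (e x).2), e.symm ((e x).1, (e x).2 + 1), e.symm ((e x).1, (e x).2 - 1)] : Fin 4 → Λ) j) 0)); let G : ∀ (L M : ℕ)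 [NeZero L] [NeZero M] (Λ : Type) [LinearOrder Λ] [Fintype Λ], (Λ ≃ ZMod L × ZMod M) → Fock (Orb Λ) → ZMod L → ℝ := fun L M _ _ Λ _ _ e ψ r => ∑ a : ZMod L, (expect ((∑ b : ZMod M, P L M Λ e (e.symm (a, b)))ᴴ * (∑ b : ZMod M, P L M Λ e (e.symm (a + r, b)))) ψ).re; ∀ U : ℝ, 0 < U → ∀ δ ∈ Set.Ioo (0 : ℝ) (3 / 10), ∀ (d₀ k₀ : ℝ) (M₁ L₀ : ℕ), 0 < d₀ → (∀ (L M : ℕ) [NeZero L] [NeZero M], Even L → Even M → M₁ ≤ M → M ≤ L → L₀ ≤ L → ∀ (Λ : Type) [LinearOrder Λ] [Fintype Λ] (e : Λ ≃ ZMod L × ZMod M), d₀ ≤ stiff L M Λ e U δ ∧ 0 < icomp L M Λ e U δ ∧ icomp L M Λ e U δ ≤ k₀) → ∃ A : ℝ, 0 < A ∧ ∃ L₁ : ℕ, ∀ (L : ℕ) [NeZero L], Even L → L₁ ≤ L → ∀ (Λ : Type) [LinearOrder Λ] [Fintype Λ] (e : Λ ≃ ZMod L × ZMod L), ∀ ψ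 : Fock (Orb Λ), star ψ ⬝ᵥ ψ = 1 → IsGroundStateInSector (H0 L L Λ e U) (Np L L δ) 0 ψ → A * (L : ℝ) ^ 2 * (L : ℝ) ^ 2 ≤ ∑ r : ZMod L, G L L Λ e ψ r

theorem closes_summed_glue (h1 : SummedDiagonalBridgeRawTest) (h2 : WidthUniformThermodynamics) :
    HubbardSuperconductivity := by
  /- RE-GLUED deciding theorem on the SUMMED DIAGONAL (strategist r1 certificate, 2026-08-17):
  `SummedDiagonalBridge` (UT ⇒ ⟨Δ_d†Δ_d⟩ ≥ A·L⁴ on the square tori, every sector ground state) and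
  `WidthUniformThermodynamics` give the summit: the summed torus functional is fed to
  `hasLongRangeOrder_even_of_le` after `sum_torusSite_two_reindex` and the identification of the
  inlined column d_{x²-y²} pair operator with `localPair dWaveFormFactor` (verbatim from rev-5 `closes`). -/
  obtain ⟨U, hU, δ, hδ, d₀, hd₀, k₀, M₁, L₀, hth⟩ := h2
  obtain ⟨A, hA, L₁, hlaw⟩ := h1 U hU δ hδ d₀ k₀ M₁ L₀ hd₀ hth
  refine ⟨U, hU, δ, ⟨hδ.1, hδ.2.trans (by norm_num)⟩, fun N ψ hE => ?_⟩
  refine Literature.MathematicalPhysics.QuantumLattice.hasLongRangeOrder_even_of_le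
    Literature.MathematicalPhysics.QuantumLattice.dWaveFormFactor ψ (fun n hn => (hE (n + 1) hn).2.1)
    hA L₁ ?_
  intro n hev hK
  obtain ⟨hN, hn1, hGS⟩ := hE (n + 1) hev
  rw [hN] at hGS
  simp only [Literature.MathematicalPhysics.QuantumLattice.pairFieldCorr_succ]
  rw [Literature.MathematicalPhysics.QuantumLattice.sum_torusSite_two_reindex]
  obtain ⟨e₀, he₀, he₀s⟩ : ∃ e : Literature.MathematicalPhysics.QuantumLattice.FermionTorus 2 (n + 1) ≃ ZMod (n + 1) × ZMod (n + 1),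
      (∀ x, e x = (Literature.MathematicalPhysics.QuantumLattice.FermionTorus.toTorusSite x 0, Literature.MathematicalPhysics.QuantumLattice.FermionTorus.toTorusSite x 1)) ∧
        ∀ p : ZMod (n + 1) × ZMod (n + 1), e.symm p = Literature.MathematicalPhysics.QuantumLattice.FermionTorus.ofTorusSite ![p.1, p.2] :=
    ⟨Literature.MathematicalPhysics.QuantumLattice.FermionTorus.equivTorusSite.trans (finTwoArrowEquiv _), fun x => rfl, fun p => rfl⟩
  have hinj : ∀ u v : Literature.MathematicalPhysics.QuantumLattice.FermionTorus 2 (n + 1),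
      Literature.MathematicalPhysics.QuantumLattice.FermionTorus.toTorusSite u = Literature.MathematicalPhysics.QuantumLattice.FermionTorus.toTorusSite v ↔ u = v := fun u v =>
    (Literature.MathematicalPhysics.QuantumLattice.FermionTorus.equivTorusSite (d := 2) (L := n + 1)).injective.eq_iff
  have hsymm : ∀ (v : Literature.MathematicalPhysics.QuantumLattice.FermionTorus 2 (n + 1)) (p : ZMod (n + 1) × ZMod (n + 1)),
      v = e₀.symm p ↔ Literature.MathematicalPhysics.QuantumLattice.FermionTorus.toTorusSite v = ![p.1, p.2] := by
    intro v p
    rw [Equiv.eq_symm_apply, he₀, Prod.ext_iff, funext_iff, Fin.forall_fin_two]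
    simp
  have hS0 : ∀ t : Fin 2 → ZMod (n + 1), t + Pi.single 0 1 = ![t 0 + 1, t 1] := fun t => by
    funext i; fin_cases i <;> simp
  have hS1 : ∀ t : Fin 2 → ZMod (n + 1), t + Pi.single 1 1 = ![t 0, t 1 + 1] := fun t => by
    funext i; fin_cases i <;> simp
  have hp1 : ∀ t : Fin 2 → ZMod (n + 1), t + Literature.Probability.LatticeModels.Torus.proj (n + 1) (Pi.single 0 1) = ![t 0 + 1, t 1] :=
    fun t => by funext i; fin_cases i <;> simp
  have hp2 : ∀ t : Fin 2 → ZMod (n + 1), t + Literature.Probability.LatticeModels.Torus.proj (n + 1) (-Pi.single 0 1) = ![t 0 - 1, t 1] :=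
    fun t => by funext i; fin_cases i <;> simp [sub_eq_add_neg]
  have hp3 : ∀ t : Fin 2 → ZMod (n + 1), t + Literature.Probability.LatticeModels.Torus.proj (n + 1) (Pi.single 1 1) = ![t 0, t 1 + 1] :=
    fun t => by funext i; fin_cases i <;> simp
  have hp4 : ∀ t : Fin 2 → ZMod (n + 1), t + Literature.Probability.LatticeModels.Torus.proj (n + 1) (-Pi.single 1 1) = ![t 0, t 1 - 1] :=
    fun t => by funext i; fin_cases i <;> simp [sub_eq_add_neg]
  have hHc : ∀ (G₁ G₂ : SimpleGraph (Literature.MathematicalPhysics.QuantumLattice.FermionTorus 2 (n + 1))) (i₁ : DecidableRel G₁.Adj)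
      (i₂ : DecidableRel G₂.Adj), (∀ x y, G₁.Adj x y ↔ G₂.Adj x y) →
      @Literature.MathematicalPhysics.QuantumLattice.hamiltonian _ _ _ G₁ i₁ 1 U = @Literature.MathematicalPhysics.QuantumLattice.hamiltonian _ _ _ G₂ i₂ 1 U := by
    intro G₁ G₂ i₁ i₂ h
    have hG : G₁ = G₂ := by ext x y; exact h x y
    subst hG
    congr
  have hd1 : Literature.MathematicalPhysics.QuantumLattice.dWaveFormFactor (Pi.single 0 1) = 1 := if_pos (Or.inl rfl)
  have hd2 : Literature.MathematicalPhysics.QuantumLattice.dWaveFormFactor (-Pi.single 0 1) = 1 := if_pos (Or.inr rfl)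
  have hd3 : Literature.MathematicalPhysics.QuantumLattice.dWaveFormFactor (Pi.single 1 1) = -1 := by
    have hne1 : (Pi.single 1 1 : Fin 2 → ℤ) ≠ Pi.single 0 1 := fun h => by simpa using congrFun h 0
    have hne2 : (Pi.single 1 1 : Fin 2 → ℤ) ≠ -Pi.single 0 1 := fun h => by simpa using congrFun h 0
    rw [Literature.MathematicalPhysics.QuantumLattice.dWaveFormFactor, if_neg (not_or.2 ⟨hne1, hne2⟩), if_pos (Or.inl rfl)]
  have hd4 : Literature.MathematicalPhysics.QuantumLattice.dWaveFormFactor (-Pi.single 1 1) = -1 := by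
    have hne3 : (-Pi.single 1 1 : Fin 2 → ℤ) ≠ Pi.single 0 1 := fun h => by simpa using congrFun h 0
    have hne4 : (-Pi.single 1 1 : Fin 2 → ℤ) ≠ -Pi.single 0 1 := fun h => by simpa using congrFun h 1
    rw [Literature.MathematicalPhysics.QuantumLattice.dWaveFormFactor, if_neg (not_or.2 ⟨hne3, hne4⟩), if_pos (Or.inr rfl)]
  have hsum : ∀ {β : Type} [AddCommMonoid β] (f : (Fin 2 → ℤ) → β), ∑ e ∈ Literature.MathematicalPhysics.QuantumLattice.unitSteps, f e =
      f (Pi.single 0 1) + f (-Pi.single 0 1) + f (Pi.single 1 1) + f (-Pi.single 1 1) := by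
    intro β _ f
    have h1 : (Pi.single 0 1 : Fin 2 → ℤ) ∉
        ({-Pi.single 0 1, Pi.single 1 1, -Pi.single 1 1} : Finset (Fin 2 → ℤ)) := by
      simp only [Finset.mem_insert, Finset.mem_singleton]; decide
    have h2 : (-Pi.single 0 1 : Fin 2 → ℤ) ∉ ({Pi.single 1 1, -Pi.single 1 1} : Finset (Fin 2 → ℤ)) := by
      simp only [Finset.mem_insert, Finset.mem_singleton]; decide
    have h3 : (Pi.single 1 1 : Fin 2 → ℤ) ∉ ({-Pi.single 1 1} : Finset (Fin 2 → ℤ)) := by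
      simp only [Finset.mem_singleton]; decide
    rw [Literature.MathematicalPhysics.QuantumLattice.unitSteps, Finset.sum_insert h1, Finset.sum_insert h2, Finset.sum_insert h3,
      Finset.sum_singleton]
    abel
  have key := hlaw (n + 1) hev hK (Literature.MathematicalPhysics.QuantumLattice.FermionTorus 2 (n + 1)) e₀ (ψ (n + 1)) hn1
  convert key ?gs using 1
  case gs =>
    dsimp only
    convert hGS using 2
    · rw [Literature.MathematicalPhysics.QuantumLattice.hubbardTorus]
      refine hHc _ _ _ _ fun x y => ?_
      simp only [SimpleGraph.fromRel_adj, Literature.MathematicalPhysics.QuantumLattice.fermionTorusGraph_adj, Literature.Probability.LatticeModels.torusGraph_adj_iff,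
        Fin.exists_fin_two, hsymm, he₀, hS0, hS1, ne_eq, hinj]
    · simp only [sq]
  · push_cast; ring
  · refine Finset.sum_congr rfl fun r _ => ?_
    simp only [Fin.sum_univ_four, Matrix.cons_val_zero, Matrix.cons_val_one, Matrix.cons_val,
      Equiv.apply_symm_apply]
    simp only [he₀s]
    refine Finset.sum_congr rfl fun a _ => ?_
    rw [Matrix.conjTranspose_sum, Finset.sum_mul]
    simp only [Finset.mul_sum, Literature.MathematicalPhysics.QuantumLattice.expect_sum, Complex.re_sum]
    refine Finset.sum_congr rfl fun b _ => Finset.sum_congr rfl fun b' _ => ?_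
    simp only [Literature.MathematicalPhysics.QuantumLattice.localPair_dWave_eq_localPairOn_unitSteps, Literature.MathematicalPhysics.QuantumLattice.localPairOn_eq_sum_singletBond, hsum,
      Literature.MathematicalPhysics.QuantumLattice.singletBond, hd1, hd2, hd3, hd4, hp1, hp2, hp3, hp4, Matrix.cons_val_zero,
      Matrix.cons_val_one]

end Summit.HubbardSuperconductivity.HubbardSuperconductivity.Theses.WidthHaldane
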